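import Summits.Ventures.DiscreteObjects.Hadamard.Hadamard4qOrder2q
import Summits.Ventures.DiscreteObjects.Hadamard.Order334Nega

/-!
# Hadamard matrices of order 4q, q ≡ 3 (mod 4) prime: automorphisms of order 2q and 4q are NEGA-cyclic; no permutation automorphism of order 2q or 4q (kernel)

Framing: lottery ticket; floor = certified bounds/negative ranges.

Cell pub-namedobj (venture DiscreteObjects), target (H), hadamard gen 12.  Uniform version of `Order334Nega` (`q = 167`).  Let `H` be
a Hadamard matrix of order `4q` with `q ≥ 5` prime, `q ≡ 3 (mod 4)` (so `4q` is not a sum of two squares), and `(π, κ, d, e)` a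
signed-permutation automorphism.
* **`hadamard4q_order2q_nega`**: if `(π, κ)` has order `2q` then every cycle sign product is `−1`: `∏_{k<2q} d (π^k i) = −1`,
  `∏_{k<2q} e (κ^k j) = −1` — the signed permutation matrices have order `4q` (`P^{2q} = −I`), the automorphism is of nega-cyclic
  (Ito / dicyclic) type and `H` is equivalent to a `2 × 2` array of negacyclic blocks of order `2q`; in particular
  (`no_hadamard4q_unsignedAut_order2q`) **`H` has no permutation (unsigned) automorphism of order `2q`** — the automorphism form of the
  two-circulant obstruction `4q ≠ a² + b²`.  Proof: by `hadamard4q_order2q_free` rows and columns are two regular orbits of length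
  `2q`; if all cycle products were `+1` the re-signed orbit blocks would be doubly periodic shift-invariant `±1` arrays with orthogonal
  rows, and `two_circulant_sq_identity` would give `a² + b² = 4q ≡ 12 (mod 16)`, impossible.
* **`hadamard4q_order4q_nega`**, **`hadamard4q_order4q_cycle`**, `no_hadamard4q_unsignedAut_order4q`: order `4q` ⇒ `π`, `κ` are single
  `4q`-cycles with cycle sign product `−1` (H equivalent to a negacyclic matrix; a circulant one would need `4q` to be a square).
* `orderOf` forms `hadamard4q_signedAut_orderOf_2q`, `hadamard4q_signedAut_orderOf_4q`.
Applies to the open orders `668, 716, 892` (`q = 167, 179, 223`, all `≡ 3 mod 4`).  Ours, not literature (nearest print: Tonchev 1985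
for order `q`; Horadam 2007 ch. 6 / Flannery 1997 for cocyclic dicyclic developments); no `sorry`.
-/

namespace Summit.Ventures.DiscreteObjects.Hadamard

open Finset BigOperators Matrix

open Literature.Combinatorics.Designs.GoethalsSeidel (IsHadamardMatrix)

variable {ι : Type*} [Fintype ι] [DecidableEq ι]

/-- `4q` with `q ≡ 3 (mod 4)` is not a sum of two integer squares (checked mod `16`) -/
theorem not_sum_two_sq_four_mul {q : ℕ} (hq4 : q % 4 = 3) (a b : ℤ) : a ^ 2 + b ^ 2 ≠ 4 * q := by
  intro h
  have h16 : ∀ u v : ZMod 16, u ^ 2 + v ^ 2 ≠ 12 := by decide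
  apply h16 (a : ZMod 16) (b : ZMod 16)
  obtain ⟨r, hr⟩ : ∃ r, q = 4 * r + 3 := ⟨q / 4, by omega⟩
  have hc := congrArg (Int.cast : ℤ → ZMod 16) h
  push_cast at hc
  rw [hc, hr]
  push_cast
  have h0 : (16 : ZMod 16) = 0 := by decide
  linear_combination (r : ZMod 16) * h0

section nega
variable {H : Matrix ι ι ℤ} {π κ : Equiv.Perm ι} {d e : ι → ℤ} {q : ℕ}

/-- **Order 2q is nega-cyclic** (`q ≥ 5` prime, `q ≡ 3 mod 4`, order `4q`): every cycle sign product of an automorphism whose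
permutation pair has order `2q` equals `−1`. -/
theorem hadamard4q_order2q_nega (hH : IsHadamardMatrix H) (hq : q.Prime) (hq5 : 5 ≤ q) (hq4 : q % 4 = 3)
    (hι : Fintype.card ι = 4 * q) (haut : IsSignedAut H π κ d e)
    (hπ : π ^ (2 * q) = 1) (hκ : κ ^ (2 * q) = 1) (h2 : π ^ 2 ≠ 1 ∨ κ ^ 2 ≠ 1) (hq1 : π ^ q ≠ 1 ∨ κ ^ q ≠ 1) :
    (∀ i, cyc π d i (2 * q) = -1) ∧ (∀ j, cyc κ e j (2 * q) = -1) := by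
  have hd := haut.1
  have he := haut.2.1
  have hA := haut.2.2
  have h2q : 0 < 2 * q := by omega
  have hDE : ∀ i j, cyc π d i (2 * q) * cyc κ e j (2 * q) = 1 := by
    intro i j
    have h := signedAut_pow haut (2 * q) i j
    rw [hπ, hκ, Equiv.Perm.one_apply, Equiv.Perm.one_apply] at h
    have hne := pm_ne_zero (hH.1 i j)
    have : (cyc π d i (2 * q) * cyc κ e j (2 * q) - 1) * H i j = 0 := by linarith
    rcases mul_eq_zero.mp this with h0 | h0
    · linarith
    · exact (hne h0).elim
  obtain ⟨i₀⟩ : Nonempty ι := by rw [← Fintype.card_pos_iff, hι]; omega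
  have main : (∀ i, cyc π d i (2 * q) = 1) → (∀ j, cyc κ e j (2 * q) = 1) → False := by
    intro hD1 hE1
    obtain ⟨hfr, hfc⟩ := hadamard4q_order2q_free hH q hq hq5 hι π κ d e haut hπ hκ h2 hq1
    set j₁ := i₀ with hj₁def
    have hO1 : (orbFin κ (2 * q) j₁).card = 2 * q := card_orbFin_of_free (hfc j₁)
    obtain ⟨j₂, hj₂⟩ : (univ \ orbFin κ (2 * q) j₁).Nonempty := by
      rw [← Finset.card_pos, Finset.card_univ_sdiff, hO1, hι]; omega
    have hj₂' : j₂ ∉ orbFin κ (2 * q) j₁ := (Finset.mem_sdiff.mp hj₂).2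
    have hO2 : (orbFin κ (2 * q) j₂).card = 2 * q := card_orbFin_of_free (hfc j₂)
    have hdisj : Disjoint (orbFin κ (2 * q) j₁) (orbFin κ (2 * q) j₂) :=
      disjoint_orbFin_of_not_mem h2q hκ (hfc j₁) (hfc j₂) (fun y _ => hfc y) hj₂'
    have hunion : orbFin κ (2 * q) j₁ ∪ orbFin κ (2 * q) j₂ = univ :=
      Finset.eq_univ_of_card _ (by rw [Finset.card_union_of_disjoint hdisj, hO1, hO2, hι]; ring)
    set x : ℕ → ℕ → ℤ := fun k m => cyc π d i₀ k * cyc κ e j₁ m * H ((π ^ k) i₀) ((κ ^ m) j₁) with hxdef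
    set y : ℕ → ℕ → ℤ := fun k m => cyc π d i₀ k * cyc κ e j₂ m * H ((π ^ k) i₀) ((κ ^ m) j₂) with hydef
    have hpm : ∀ (j : ι) (k m : ℕ), cyc π d i₀ k * cyc κ e j m * H ((π ^ k) i₀) ((κ ^ m) j) = 1 ∨
        cyc π d i₀ k * cyc κ e j m * H ((π ^ k) i₀) ((κ ^ m) j) = -1 := by
      intro j k m
      rcases cyc_pm π d hd i₀ k with h1 | h1 <;> rcases cyc_pm κ e he j m with h2 | h2 <;>
        rcases hH.1 ((π ^ k) i₀) ((κ ^ m) j) with h3 | h3 <;> simp [h1, h2, h3]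
    have hshift : ∀ (j : ι) (k m : ℕ), cyc π d i₀ (k + 1) * cyc κ e j (m + 1) * H ((π ^ (k + 1)) i₀) ((κ ^ (m + 1)) j)
        = cyc π d i₀ k * cyc κ e j m * H ((π ^ k) i₀) ((κ ^ m) j) := by
      intro j k m
      rw [cyc_succ', cyc_succ', pow_succ', pow_succ', Equiv.Perm.mul_apply, Equiv.Perm.mul_apply, hA]
      have h1 := pm_mul_self (hd ((π ^ k) i₀))
      have h2 := pm_mul_self (he ((κ ^ m) j))
      calc cyc π d i₀ k * d ((π ^ k) i₀) * (cyc κ e j m * e ((κ ^ m) j)) *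
            (d ((π ^ k) i₀) * e ((κ ^ m) j) * H ((π ^ k) i₀) ((κ ^ m) j))
          = (d ((π ^ k) i₀) * d ((π ^ k) i₀)) * (e ((κ ^ m) j) * e ((κ ^ m) j)) *
            (cyc π d i₀ k * cyc κ e j m * H ((π ^ k) i₀) ((κ ^ m) j)) := by ring
        _ = cyc π d i₀ k * cyc κ e j m * H ((π ^ k) i₀) ((κ ^ m) j) := by rw [h1, h2, one_mul, one_mul]
    have hperk : ∀ (j : ι) (k m : ℕ), cyc π d i₀ (k + 2 * q) * cyc κ e j m * H ((π ^ (k + 2 * q)) i₀) ((κ ^ m) j)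
        = cyc π d i₀ k * cyc κ e j m * H ((π ^ k) i₀) ((κ ^ m) j) := by
      intro j k m
      rw [cyc_add, hD1, mul_one, pow_add, hπ, mul_one]
    have hperm : ∀ (j : ι) (k m : ℕ), cyc π d i₀ k * cyc κ e j (m + 2 * q) * H ((π ^ k) i₀) ((κ ^ (m + 2 * q)) j)
        = cyc π d i₀ k * cyc κ e j m * H ((π ^ k) i₀) ((κ ^ m) j) := by
      intro j k m
      rw [cyc_add, hE1, mul_one, pow_add, hκ, mul_one]
    have horth : ∀ k, 0 < k → k < 2 * q → ∑ m ∈ range (2 * q), (x 0 m * x k m + y 0 m * y k m) = 0 := by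
      intro k hk0 hk
      have hrow := hadamard_row_orth H hH (Ne.symm (hfr i₀ k hk0 hk))
      rw [← Finset.sum_filter_add_sum_filter_not univ (fun j => j ∈ orbFin κ (2 * q) j₁)] at hrow
      have hf1 : univ.filter (fun j => j ∈ orbFin κ (2 * q) j₁) = orbFin κ (2 * q) j₁ := by
        ext j; simp
      have hf2 : univ.filter (fun j => ¬ j ∈ orbFin κ (2 * q) j₁) = orbFin κ (2 * q) j₂ := by
        ext j
        simp only [Finset.mem_filter, Finset.mem_univ, true_and]
        constructor
        · intro hj
          have : j ∈ orbFin κ (2 * q) j₁ ∪ orbFin κ (2 * q) j₂ := by rw [hunion]; exact Finset.mem_univ j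
          rcases Finset.mem_union.mp this with h | h
          · exact absurd h hj
          · exact h
        · intro hj h1
          exact Finset.disjoint_left.mp hdisj h1 hj
      rw [hf1, hf2, sum_orbFin_of_free (hfc j₁), sum_orbFin_of_free (hfc j₂)] at hrow
      have e1 : ∀ (j : ι) (m : ℕ),
          (cyc π d i₀ 0 * cyc κ e j m * H ((π ^ 0) i₀) ((κ ^ m) j)) * (cyc π d i₀ k * cyc κ e j m * H ((π ^ k) i₀) ((κ ^ m) j))
          = cyc π d i₀ k * (H i₀ ((κ ^ m) j) * H ((π ^ k) i₀) ((κ ^ m) j)) := by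
        intro j m
        have h0 : cyc π d i₀ 0 = 1 := by simp [cyc]
        have h2 := pm_mul_self (cyc_pm κ e he j m)
        rw [h0, pow_zero, Equiv.Perm.one_apply]
        calc 1 * cyc κ e j m * H i₀ ((κ ^ m) j) * (cyc π d i₀ k * cyc κ e j m * H ((π ^ k) i₀) ((κ ^ m) j))
            = (cyc κ e j m * cyc κ e j m) * (cyc π d i₀ k * (H i₀ ((κ ^ m) j) * H ((π ^ k) i₀) ((κ ^ m) j))) := by ring
          _ = _ := by rw [h2, one_mul]
      simp only [hxdef, hydef]
      rw [Finset.sum_add_distrib, Finset.sum_congr rfl fun m _ => e1 j₁ m, Finset.sum_congr rfl fun m _ => e1 j₂ m,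
        ← Finset.mul_sum, ← Finset.mul_sum, ← mul_add, hrow, mul_zero]
    have hsq := two_circulant_sq_identity (2 * q) x y (fun k m => hpm j₁ k m) (fun k m => hpm j₂ k m)
      (fun k m => hshift j₁ k m) (fun k m => hshift j₂ k m) (fun k m => hperk j₁ k m) (fun k m => hperm j₁ k m)
      (fun k m => hperk j₂ k m) (fun k m => hperm j₂ k m) horth
    exact not_sum_two_sq_four_mul hq4 _ _ (by rw [hsq]; push_cast; ring)
  have hD : ∀ i, cyc π d i (2 * q) = -1 := by
    intro i
    rcases cyc_pm π d hd i (2 * q) with h | h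
    · exfalso
      have hE1 : ∀ j, cyc κ e j (2 * q) = 1 := by
        intro j; have := hDE i j; rw [h, one_mul] at this; exact this
      have hD1 : ∀ i', cyc π d i' (2 * q) = 1 := by
        intro i'; have := hDE i' i₀; rw [hE1 i₀, mul_one] at this; exact this
      exact main hD1 hE1
    · exact h
  refine ⟨hD, fun j => ?_⟩
  have := hDE i₀ j
  rw [hD i₀] at this
  linarith [cyc_pm κ e he j (2 * q)]

/-- **No permutation automorphism of order 2q** (order `4q`, `q ≥ 5` prime, `q ≡ 3 mod 4`). -/
theorem no_hadamard4q_unsignedAut_order2q (hH : IsHadamardMatrix H) (hq : q.Prime) (hq5 : 5 ≤ q) (hq4 : q % 4 = 3)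
    (hι : Fintype.card ι = 4 * q) (hA : ∀ i j, H (π i) (κ j) = H i j)
    (hπ : π ^ (2 * q) = 1) (hκ : κ ^ (2 * q) = 1) (h2 : π ^ 2 ≠ 1 ∨ κ ^ 2 ≠ 1) (hq1 : π ^ q ≠ 1 ∨ κ ^ q ≠ 1) : False := by
  have haut : IsSignedAut H π κ (fun _ => 1) (fun _ => 1) :=
    ⟨fun _ => Or.inl rfl, fun _ => Or.inl rfl, fun i j => by rw [hA i j]; ring⟩
  obtain ⟨i⟩ : Nonempty ι := by rw [← Fintype.card_pos_iff, hι]; omega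
  have h := (hadamard4q_order2q_nega hH hq hq5 hq4 hι haut hπ hκ h2 hq1).1 i
  have h1 : cyc π (fun _ => (1 : ℤ)) i (2 * q) = 1 := by simp [cyc]
  rw [h1] at h
  norm_num at h

end nega

section order4q
variable {H : Matrix ι ι ℤ} {π κ : Equiv.Perm ι} {d e : ι → ℤ} {q : ℕ}

/-- **Order 4q is negacyclic**: `π^(2q)`, `κ^(2q)` are fixed-point-free and the cycle sign products over `4q` steps are `−1`. -/
theorem hadamard4q_order4q_nega (hH : IsHadamardMatrix H) (hq : q.Prime) (hq5 : 5 ≤ q) (hq4 : q % 4 = 3)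
    (hι : Fintype.card ι = 4 * q) (haut : IsSignedAut H π κ d e)
    (hπ : π ^ (4 * q) = 1) (hκ : κ ^ (4 * q) = 1) (h4 : π ^ 4 ≠ 1 ∨ κ ^ 4 ≠ 1) (h2q : π ^ (2 * q) ≠ 1 ∨ κ ^ (2 * q) ≠ 1) :
    ((∀ i, (π ^ (2 * q)) i ≠ i) ∧ (∀ j, (κ ^ (2 * q)) j ≠ j)) ∧
      (∀ i, cyc π d i (4 * q) = -1) ∧ (∀ j, cyc κ e j (4 * q) = -1) := by
  have haut2 : IsSignedAut H (π ^ 2) (κ ^ 2) (fun i => cyc π d i 2) (fun j => cyc κ e j 2) := isSignedAut_pow haut 2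
  have e42 : 4 * q = 2 * (2 * q) := by ring
  have hπ2 : (π ^ 2) ^ (2 * q) = 1 := by rw [← pow_mul, ← e42]; exact hπ
  have hκ2 : (κ ^ 2) ^ (2 * q) = 1 := by rw [← pow_mul, ← e42]; exact hκ
  have h2' : (π ^ 2) ^ 2 ≠ 1 ∨ (κ ^ 2) ^ 2 ≠ 1 := by rw [← pow_mul, ← pow_mul]; exact h4
  have hq' : (π ^ 2) ^ q ≠ 1 ∨ (κ ^ 2) ^ q ≠ 1 := by rw [← pow_mul, ← pow_mul]; exact h2q
  obtain ⟨hr, hc⟩ := hadamard4q_order2q_fpf hH q hq hq5 hι _ _ _ _ haut2 hπ2 hκ2 h2' hq'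
  obtain ⟨hD, hE⟩ := hadamard4q_order2q_nega hH hq hq5 hq4 hι haut2 hπ2 hκ2 h2' hq'
  refine ⟨⟨fun i => by rw [← pow_mul] at hr; exact hr i, fun j => by rw [← pow_mul] at hc; exact hc j⟩,
    fun i => ?_, fun j => ?_⟩
  · rw [e42, ← cyc_pow_mul π d i 2 (2 * q)]; exact hD i
  · rw [e42, ← cyc_pow_mul κ e j 2 (2 * q)]; exact hE j

/-- **Order 4q: single cycles** — `π^k`, `κ^k` have no fixed point for `0 < k < 4q`. -/
theorem hadamard4q_order4q_cycle (hH : IsHadamardMatrix H) (hq : q.Prime) (hq5 : 5 ≤ q) (hq4 : q % 4 = 3)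
    (hι : Fintype.card ι = 4 * q) (haut : IsSignedAut H π κ d e)
    (hπ : π ^ (4 * q) = 1) (hκ : κ ^ (4 * q) = 1) (h4 : π ^ 4 ≠ 1 ∨ κ ^ 4 ≠ 1) (h2q : π ^ (2 * q) ≠ 1 ∨ κ ^ (2 * q) ≠ 1) :
    (∀ i k, 0 < k → k < 4 * q → (π ^ k) i ≠ i) ∧ (∀ j k, 0 < k → k < 4 * q → (κ ^ k) j ≠ j) := by
  obtain ⟨⟨hr, hc⟩, -, -⟩ := hadamard4q_order4q_nega hH hq hq5 hq4 hι haut hπ hκ h4 h2q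
  have hfix := hadamard4q_fixedRows hH q hq hq5 hι (π ^ 4) (κ ^ 4) _ _ (isSignedAut_pow haut 4)
    (by rw [← pow_mul]; exact hπ) (by rw [← pow_mul]; exact hκ) h4
  have fpf4 : ∀ (σ : Equiv.Perm ι), (univ.filter fun i => (σ ^ 4) i = i).card = 0 → ∀ i, (σ ^ 4) i ≠ i := by
    intro σ h0 i hi
    have hmem : i ∈ univ.filter (fun i => (σ ^ 4) i = i) := by simp [hi]
    rw [Finset.card_eq_zero.mp h0] at hmem
    simp at hmem
  have key : ∀ (σ : Equiv.Perm ι), σ ^ (4 * q) = 1 → (∀ i, (σ ^ (2 * q)) i ≠ i) → (∀ i, (σ ^ 4) i ≠ i) →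
      ∀ i k, 0 < k → k < 4 * q → (σ ^ k) i ≠ i := by
    intro σ hσ h2q' h4' i k hk0 hk hk_fix
    by_cases hdvd : q ∣ k
    · obtain ⟨t, rfl⟩ := hdvd
      have ht : t < 4 := Nat.lt_of_mul_lt_mul_left (by rw [mul_comm 4 q] at hk; exact hk)
      have ht0 : 0 < t := Nat.pos_of_ne_zero (by rintro rfl; simp at hk0)
      have h2q_of_q : (σ ^ q) i = i → False := fun h1 =>
        h2q' i (by rw [mul_comm 2 q, pow_mul]; exact perm_pow_apply_of_fixed _ h1 2)
      interval_cases t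
      · exact h2q_of_q (by simpa using hk_fix)
      · exact h2q' i (by rw [mul_comm 2 q]; exact hk_fix)
      · have h3 : (σ ^ (q * 3 * 3)) i = i := by rw [pow_mul]; exact perm_pow_apply_of_fixed _ hk_fix 3
        have e1 : σ ^ (q * 3 * 3) = σ ^ q := by
          rw [show q * 3 * 3 = (4 * q) * 2 + q by ring, pow_add, pow_mul, hσ, one_pow, one_mul]
        rw [e1] at h3
        exact h2q_of_q h3
    · have hcop : Nat.Coprime k q := (Nat.Prime.coprime_iff_not_dvd hq).mpr hdvd |>.symm
      have h1 : ((σ ^ 4) ^ k) i = i := by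
        rw [← pow_mul, mul_comm, pow_mul]
        exact perm_pow_apply_of_fixed _ hk_fix 4
      have h2 : ((σ ^ 4) ^ q) i = i := by
        rw [← pow_mul, hσ, Equiv.Perm.one_apply]
      exact h4' i (perm_fixed_of_pow_coprime (σ ^ 4) hcop hq.one_lt h1 h2)
  exact ⟨key π hπ hr (fpf4 π hfix.1), key κ hκ hc (fpf4 κ hfix.2.1)⟩

/-- **No permutation automorphism of order 4q.** -/
theorem no_hadamard4q_unsignedAut_order4q (hH : IsHadamardMatrix H) (hq : q.Prime) (hq5 : 5 ≤ q) (hq4 : q % 4 = 3)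
    (hι : Fintype.card ι = 4 * q) (hA : ∀ i j, H (π i) (κ j) = H i j)
    (hπ : π ^ (4 * q) = 1) (hκ : κ ^ (4 * q) = 1) (h4 : π ^ 4 ≠ 1 ∨ κ ^ 4 ≠ 1) (h2q : π ^ (2 * q) ≠ 1 ∨ κ ^ (2 * q) ≠ 1) :
    False := by
  have haut : IsSignedAut H π κ (fun _ => 1) (fun _ => 1) :=
    ⟨fun _ => Or.inl rfl, fun _ => Or.inl rfl, fun i j => by rw [hA i j]; ring⟩
  obtain ⟨i⟩ : Nonempty ι := by rw [← Fintype.card_pos_iff, hι]; omega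
  have h := (hadamard4q_order4q_nega hH hq hq5 hq4 hι haut hπ hκ h4 h2q).2.1 i
  have h1 : cyc π (fun _ => (1 : ℤ)) i (4 * q) = 1 := by simp [cyc]
  rw [h1] at h
  norm_num at h

end order4q

section orderOf
variable {H : Matrix ι ι ℤ} {π κ : Equiv.Perm ι} {d e : ι → ℤ}

/-- **Order form, 2q.**  In a Hadamard matrix of order `4q` (`q ≥ 5` prime, `q ≡ 3 mod 4`) a signed automorphism whose
permutation pair has order `2q` is semiregular (two row orbits, two column orbits of length `2q`) and nega-cyclic. -/
theorem hadamard4q_signedAut_orderOf_2q (hH : IsHadamardMatrix H) (q : ℕ) (hq : q.Prime) (hq5 : 5 ≤ q) (hq4 : q % 4 = 3)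
    (hι : Fintype.card ι = 4 * q) (π κ : Equiv.Perm ι) (d e : ι → ℤ) (haut : IsSignedAut H π κ d e)
    (hord : orderOf ((π, κ) : Equiv.Perm ι × Equiv.Perm ι) = 2 * q) :
    ((∀ i k, 0 < k → k < 2 * q → (π ^ k) i ≠ i) ∧ (∀ j k, 0 < k → k < 2 * q → (κ ^ k) j ≠ j)) ∧
      (∀ i, cyc π d i (2 * q) = -1) ∧ (∀ j, cyc κ e j (2 * q) = -1) := by
  obtain ⟨hπ, hκ, h2⟩ := pow_data_of_orderOf hord (a := 2) (by norm_num) (by omega)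
  obtain ⟨-, -, hq1⟩ := pow_data_of_orderOf hord (a := q) hq.pos (by omega)
  exact ⟨hadamard4q_order2q_free hH q hq hq5 hι π κ d e haut hπ hκ h2 hq1,
    hadamard4q_order2q_nega hH hq hq5 hq4 hι haut hπ hκ h2 hq1⟩

/-- **Order form, 4q.**  A signed automorphism whose permutation pair has order `4q` consists of two single `4q`-cycles with cycle
sign products `−1` (H is equivalent to a negacyclic matrix). -/
theorem hadamard4q_signedAut_orderOf_4q (hH : IsHadamardMatrix H) (q : ℕ) (hq : q.Prime) (hq5 : 5 ≤ q) (hq4 : q % 4 = 3)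
    (hι : Fintype.card ι = 4 * q) (π κ : Equiv.Perm ι) (d e : ι → ℤ) (haut : IsSignedAut H π κ d e)
    (hord : orderOf ((π, κ) : Equiv.Perm ι × Equiv.Perm ι) = 4 * q) :
    ((∀ i k, 0 < k → k < 4 * q → (π ^ k) i ≠ i) ∧ (∀ j k, 0 < k → k < 4 * q → (κ ^ k) j ≠ j)) ∧
      (∀ i, cyc π d i (4 * q) = -1) ∧ (∀ j, cyc κ e j (4 * q) = -1) := by
  obtain ⟨hπ, hκ, h4⟩ := pow_data_of_orderOf hord (a := 4) (by norm_num) (by omega)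
  obtain ⟨-, -, h2q⟩ := pow_data_of_orderOf hord (a := 2 * q) (by omega) (by omega)
  obtain ⟨-, hD, hE⟩ := hadamard4q_order4q_nega hH hq hq5 hq4 hι haut hπ hκ h4 h2q
  exact ⟨hadamard4q_order4q_cycle hH hq hq5 hq4 hι haut hπ hκ h4 h2q, hD, hE⟩

/-- **Unsigned summary.**  A Hadamard matrix of order `4q` (`q ≥ 5` prime, `q ≡ 3 mod 4`) has no permutation automorphism pair
of order `2q` or `4q`. -/
theorem no_hadamard4q_unsignedAut_orderOf (hH : IsHadamardMatrix H) (q : ℕ) (hq : q.Prime) (hq5 : 5 ≤ q) (hq4 : q % 4 = 3)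
    (hι : Fintype.card ι = 4 * q) (hA : ∀ i j, H (π i) (κ j) = H i j)
    (hord : orderOf ((π, κ) : Equiv.Perm ι × Equiv.Perm ι) = 2 * q ∨ orderOf ((π, κ) : Equiv.Perm ι × Equiv.Perm ι) = 4 * q) :
    False := by
  rcases hord with h | h
  · obtain ⟨hπ, hκ, h2⟩ := pow_data_of_orderOf h (a := 2) (by norm_num) (by omega)
    obtain ⟨-, -, hq1⟩ := pow_data_of_orderOf h (a := q) hq.pos (by omega)
    exact no_hadamard4q_unsignedAut_order2q hH hq hq5 hq4 hι hA hπ hκ h2 hq1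
  · obtain ⟨hπ, hκ, h4⟩ := pow_data_of_orderOf h (a := 4) (by norm_num) (by omega)
    obtain ⟨-, -, h2q⟩ := pow_data_of_orderOf h (a := 2 * q) (by omega) (by omega)
    exact no_hadamard4q_unsignedAut_order4q hH hq hq5 hq4 hι hA hπ hκ h4 h2q

end orderOf

end Summit.Ventures.DiscreteObjects.Hadamard
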